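import Literature.Analysis.Complex.ArgumentPrincipleEdgeZeros
import HarnessLib

/-!
# Moving the edges of a rectangle off the zeros of an analytic function

Topic `Literature/Analysis/Complex` (trunk T-ANALYSIS support). Everything here is PROVED; there
are no definitions and no named facts.

Littlewood's lemma and the argument principle (Titchmarsh §9.9, §10.28; Conrey 1983 §4) are
applied to rectangles whose edges carry no zeros of the function; since an analytic function not
identically zero has only finitely many zeros on a compact rectangle
(`Literature.Analysis.Complex.finite_zeros_closed_reProdIm`), the edges can always be moved
slightly ("we may suppose that `T` is not the ordinate of a zero"):

* `exists_height_avoiding_zeros` — in every interval of heights `(t₁, t₂)` there is a `t` with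
  `f(x + it) ≠ 0` for all `x ∈ [x₁, x₂]`;
* `exists_abscissa_avoiding_zeros_integral_le` — for every `ε > 0` there is an abscissa
  `a' ∈ [a − δ, a)` with `f(a' + it) ≠ 0` for all `t ∈ [t₁, t₂]` **and**
  `∫_{t₁}^{t₂} ‖f(a'+it)‖² dt ≤ ∫_{t₁}^{t₂} ‖f(a+it)‖² dt + ε` (uniform continuity of `‖f‖²` on the
  compact strip `[a − δ, a] × [t₁, t₂]`).

## References

* E. C. Titchmarsh, *The Theory of the Riemann Zeta-Function*, 2nd ed. (1986), §9.9, §10.28.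
  [Titchmarsh1986]
-/

noncomputable section

open Complex Set Filter Topology Metric MeasureTheory intervalIntegral

namespace Literature.Analysis.Complex

variable {f : ℂ → ℂ}

/-- **A height avoiding the zeros.** If `f` is analytic on the closed rectangle
`[x₁, x₂] × [t₁, t₂]` (`x₁ ≤ x₂`, `t₁ < t₂`) and not identically zero there, then some
`t ∈ (t₁, t₂)` satisfies `f(x + it) ≠ 0` for all `x ∈ [x₁, x₂]`. [folklore] -/
theorem exists_height_avoiding_zeros {x₁ x₂ t₁ t₂ : ℝ} (hx : x₁ ≤ x₂) (ht : t₁ < t₂)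
    (hf : AnalyticOnNhd ℂ f (Icc x₁ x₂ ×ℂ Icc t₁ t₂)) {w : ℂ} (hw : w ∈ Icc x₁ x₂ ×ℂ Icc t₁ t₂)
    (hfw : f w ≠ 0) :
    ∃ t ∈ Ioo t₁ t₂, ∀ x ∈ Icc x₁ x₂, f (x + t * I) ≠ 0 := by
  have hfin := finite_zeros_closed_reProdIm hx ht.le hf hw hfw
  have hB : ((fun ρ : ℂ ↦ ρ.im) '' {ρ : ℂ | f ρ = 0 ∧ ρ ∈ Icc x₁ x₂ ×ℂ Icc t₁ t₂}).Finite :=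
    hfin.image _
  obtain ⟨t, htI, htB⟩ := (Ioo_infinite ht).exists_notMem_finite hB
  refine ⟨t, htI, fun x hx h0 ↦ htB ⟨x + t * I, ⟨h0, ?_⟩, by simp⟩⟩
  exact Complex.mem_reProdIm.2 ⟨by simpa using hx, by simpa using Ioo_subset_Icc_self htI⟩

/-- **An abscissa avoiding the zeros, with the mean square under control.** If `f` is analytic on
the closed strip `[a − δ, a] × [t₁, t₂]` (`δ > 0`, `t₁ < t₂`) and not identically zero there, then
for every `ε > 0` there is `a' ∈ [a − δ, a)` with `f(a' + it) ≠ 0` for all `t ∈ [t₁, t₂]` and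
`∫_{t₁}^{t₂} ‖f(a'+it)‖² dt ≤ ∫_{t₁}^{t₂} ‖f(a+it)‖² dt + ε`. [folklore] -/
theorem exists_abscissa_avoiding_zeros_integral_le {a δ t₁ t₂ : ℝ} (hδ : 0 < δ) (ht : t₁ < t₂)
    (hf : AnalyticOnNhd ℂ f (Icc (a - δ) a ×ℂ Icc t₁ t₂)) {w : ℂ} (hw : w ∈ Icc (a - δ) a ×ℂ Icc t₁ t₂)
    (hfw : f w ≠ 0) {ε : ℝ} (hε : 0 < ε) :
    ∃ a' ∈ Ico (a - δ) a, (∀ t ∈ Icc t₁ t₂, f (a' + t * I) ≠ 0) ∧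
      ∫ t in t₁..t₂, ‖f (a' + t * I)‖ ^ 2 ≤ (∫ t in t₁..t₂, ‖f (a + t * I)‖ ^ 2) + ε := by
  -- the continuous function `g(x, t) = ‖f(x + it)‖²` on the compact `[a-δ, a] × [t₁, t₂]`
  set K : Set (ℝ × ℝ) := Icc (a - δ) a ×ˢ Icc t₁ t₂ with hK
  have hKc : IsCompact K := isCompact_Icc.prod isCompact_Icc
  set g : ℝ × ℝ → ℝ := fun p ↦ ‖f (p.1 + p.2 * I)‖ ^ 2 with hg
  have hlin : Continuous fun p : ℝ × ℝ ↦ (p.1 : ℂ) + p.2 * I := by fun_prop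
  have hmemK : ∀ p ∈ K, ((p.1 : ℂ) + p.2 * I) ∈ Icc (a - δ) a ×ℂ Icc t₁ t₂ := fun p hp ↦
    Complex.mem_reProdIm.2 ⟨by simpa using hp.1, by simpa using hp.2⟩
  have hgc : ContinuousOn g K := by
    intro p hp
    have h1 : ContinuousAt f ((p.1 : ℂ) + p.2 * I) := (hf _ (hmemK p hp)).continuousAt
    exact ((h1.comp (f := fun p : ℝ × ℝ ↦ (p.1 : ℂ) + p.2 * I) hlin.continuousAt).norm.pow 2).continuousWithinAt
  have hgu := hKc.uniformContinuousOn_of_continuous hgc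
  rw [Metric.uniformContinuousOn_iff_le] at hgu
  have hU : 0 < t₂ - t₁ := sub_pos.2 ht
  obtain ⟨δ', hδ', hclose⟩ := hgu (ε / (t₂ - t₁)) (by positivity)
  -- the zeros of `f` in the strip are finite: avoid their abscissae
  have hfin := finite_zeros_closed_reProdIm (by linarith) ht.le hf hw hfw
  have hB : ((fun ρ : ℂ ↦ ρ.re) '' {ρ : ℂ | f ρ = 0 ∧ ρ ∈ Icc (a - δ) a ×ℂ Icc t₁ t₂}).Finite :=
    hfin.image _
  set a₀ : ℝ := max (a - δ) (a - δ') with ha₀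
  have ha₀a : a₀ < a := max_lt (by linarith) (by linarith)
  obtain ⟨a', ha'I, ha'B⟩ := (Ioo_infinite ha₀a).exists_notMem_finite hB
  have ha'1 : a - δ ≤ a' := le_trans (le_max_left _ _) ha'I.1.le
  have ha'2 : a - δ' < a' := lt_of_le_of_lt (le_max_right _ _) ha'I.1
  refine ⟨a', ⟨ha'1, ha'I.2⟩, fun t htt h0 ↦ ha'B ⟨a' + t * I, ⟨h0, ?_⟩, by simp⟩, ?_⟩
  · exact Complex.mem_reProdIm.2 ⟨by simpa using (⟨ha'1, ha'I.2.le⟩ : a' ∈ Icc (a - δ) a),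
      by simpa using htt⟩
  -- the integrals
  have hcont : ∀ x ∈ Icc (a - δ) a, ContinuousOn (fun t : ℝ ↦ ‖f (x + t * I)‖ ^ 2) (Icc t₁ t₂) := by
    intro x hx t htt
    have h1 : ContinuousAt f ((x : ℂ) + t * I) :=
      (hf _ (Complex.mem_reProdIm.2 ⟨by simpa using hx, by simpa using htt⟩)).continuousAt
    have hl : Continuous fun t : ℝ ↦ (x : ℂ) + t * I := by fun_prop
    exact ((h1.comp (f := fun t : ℝ ↦ (x : ℂ) + t * I) hl.continuousAt).norm.pow 2).continuousWithinAt
  have ha'mem : a' ∈ Icc (a - δ) a := ⟨ha'1, ha'I.2.le⟩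
  have hamem : a ∈ Icc (a - δ) a := ⟨by linarith, le_rfl⟩
  have hi1 := (hcont a' ha'mem).intervalIntegrable_of_Icc (μ := volume) ht.le
  have hi2 := (hcont a hamem).intervalIntegrable_of_Icc (μ := volume) ht.le
  have hdiff : ‖∫ t in t₁..t₂, (‖f (a' + t * I)‖ ^ 2 - ‖f (a + t * I)‖ ^ 2)‖ ≤
      ε / (t₂ - t₁) * |t₂ - t₁| := by
    refine intervalIntegral.norm_integral_le_of_norm_le_const fun t htt ↦ ?_
    rw [uIoc_of_le ht.le] at htt
    have htt' : t ∈ Icc t₁ t₂ := Ioc_subset_Icc_self htt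
    have hd : dist (a', t) (a, t) ≤ δ' := by
      rw [Prod.dist_eq]
      dsimp only
      rw [Real.dist_eq, dist_self, max_eq_left (abs_nonneg _), abs_sub_comm,
        abs_of_nonneg (by linarith [ha'I.2])]
      linarith
    have h := hclose (a', t) ⟨ha'mem, htt'⟩ (a, t) ⟨hamem, htt'⟩ hd
    rw [Real.dist_eq] at h
    simpa [hg, Real.norm_eq_abs] using h
  rw [abs_of_pos hU, div_mul_cancel₀ _ hU.ne'] at hdiff
  have hsplit : ∫ t in t₁..t₂, ‖f (a' + t * I)‖ ^ 2 =
      (∫ t in t₁..t₂, ‖f (a + t * I)‖ ^ 2) +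
        ∫ t in t₁..t₂, (‖f (a' + t * I)‖ ^ 2 - ‖f (a + t * I)‖ ^ 2) := by
    rw [intervalIntegral.integral_sub hi1 hi2]; ring
  rw [hsplit]
  have := Real.le_norm_self (∫ t in t₁..t₂, (‖f (a' + t * I)‖ ^ 2 - ‖f (a + t * I)‖ ^ 2))
  linarith

end Literature.Analysis.Complex

end
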